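import Mathlib.RingTheory.Polynomial.Cyclotomic.Roots
import Mathlib.RingTheory.Polynomial.Cyclotomic.Eval
import Mathlib.RingTheory.RootsOfUnity.PrimitiveRoots
import Mathlib.RingTheory.IntegralClosure.IntegrallyClosed
import Mathlib.RingTheory.IntegralClosure.IsIntegralClosure.Basic
import Mathlib.FieldTheory.IsAlgClosed.Basic
import Mathlib.FieldTheory.IsAlgClosed.AlgebraicClosure
import Mathlib.Data.Nat.Log
import Mathlib.Data.Nat.Prime.Pow
import Mathlib.Data.Nat.Totient
import Literature.GroupTheory.ArithmeticGroups.NeatSubgroups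
import HarnessLib

/-!
# Periodic elements unipotent modulo `n`: roots of unity `α` with `(α - 1)^k ∈ n𝒪` and periodic integral matrices `A` with `(A - 1)^k ∈ n M_g(ℤ)` (Silverberg–Zarhin 1996)

Family `hodge` (rigidity of abelian varieties with level structure: "Serre's Lemma relies on the
fact that if `n ≥ 3` then every root of unity which is congruent to `1` modulo `n` is `1`"),
layer `Literature/GroupTheory/ArithmeticGroups`; companion of `MinkowskiTorsionFree` (the case
`k = 1`, `n ≥ 3`: MINKOWSKI), `MinkowskiLemmaLocalRing` / `ComplexTorusPolarizedAutomorphismsLevelTwo`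
(`k = 1`, `n = 2`: SERRE's lemma) and `NeatSubgroups`. Two definitions with bodies (the printed
`N(k)` and `R(k, n)`) and theorems; no named fact (D-0026).

A. Silverberg, Yu. G. Zarhin, *Variations on a theme of Minkowski and Serre*, J. Pure Appl. Algebra
111 (1996) 285–302 [SilverbergZarhin1996] (held text `paper:doi-10-1016-0022-4049-95-00113-1`).

**Definition 2.1** (p. 286). "If `k` is a positive integer, define a finite set `N(k)` by
`N(k) = {prime powers ℓ^m : 0 < m(ℓ - 1) ≤ k}` [the printed examples `N(1) = {1, 2}`,
`N(2) = {1, 2, 3, 4}`, `N(3) = {1, 2, 3, 4, 8}`, `N(4) = {1, 2, 3, 4, 5, 8, 9, 16}` include `1`].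
Let `R(k, 1) = 0`; if `n` is a positive integer which is not in `N(k)`, let `R(k, n) = 1`; if
`1 ≠ n = ℓ^m ∈ N(k)` with `ℓ` a prime, let `R(k, n) = ℓ^{r(k,n)}` where
`r(k, n) = max{r ∈ ℤ⁺ : m(ℓ - 1)ℓ^{r-1} ≤ k}`." (`SilverbergZarhin.exceptionalSet`,
`SilverbergZarhin.orderBound`; printed values `R(1,2) = 2`, `R(1,n) = 1 (n ≥ 3)`, `R(2,2) = 4`,
`R(2,3) = 3`, `R(2,4) = 2`, `R(2,n) = 1 (n ≥ 5)` are checked below.)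

**Corollary 3.3** (p. 288; the case `b(1) = ⋯ = b(k) = 1` of Theorem 3.1). "Suppose `n` and `k`
are positive integers, `𝒪` is an integral domain of characteristic zero such that no rational prime
which divides `n` is a unit in `𝒪`, `α ∈ 𝒪`, `α` has finite multiplicative order, and
`(α - 1)^k ∈ n𝒪`. Then `α^{R(k,n)} = 1`; in particular, `α = 1` if `n ∉ N(k)`."
(`SilverbergZarhin.pow_orderBound_eq_one`, `SilverbergZarhin.eq_one_of_not_mem_exceptionalSet`; the
structural content of the printed proof — "`n ∈ N(k)`. Further, `n` is a power of every prime which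
divides the order of `α`, so the order of `α` is a prime power `ℓ^r`, with `m(ℓ - 1)ℓ^{r-1} ≤ k`"
(p. 287) — is `SilverbergZarhin.exists_eq_prime_pow_of_dvd_orderOf`.)

**Theorem 6.2** (p. 291), for `𝒪 = ℤ` [the printed statement allows any ring `𝒪` with
`𝒪 → 𝒪 ⊗ ℚ` injective and a mild hypothesis (a) or (b), both satisfied by `ℤ`]: "If `A ∈ M_g(𝒪)`
is a matrix of finite multiplicative order such that `(A - I)^k ∈ nM_g(𝒪)`, then
`A^{R(k,n)} = I`." (`SilverbergZarhin.matrix_pow_orderBound_eq_one`; `matrix_eq_one_of_not_mem_exceptionalSet`; the cases `k = 2`, `n = 3, 4, ≥ 5`.)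
The case `k = 1` is Minkowski (`n ≥ 3`, the tree's `Matrix.eq_one_of_pow_eq_one_of_dvd_sub_one`) and
Serre (`n = 2`, `Matrix.sq_eq_one_of_isOfFinOrder_of_two_dvd_sub_one`), neither restated here.
**Remark 3.2** ("the upper bound of `R(k, n)` … is sharp"): the exponents `R(2, 2) = 4`,
`R(2, 3) = 3`, `R(2, 4) = 2` are attained by `(0 -1; 1 0)`, `(0 -1; 1 -1)`, `-1`
(`sharp_two_two`, `sharp_two_three`, `sharp_two_four`).

Proof of Corollary 3.3 (as printed, p. 287): let `ℓ^r` exactly divide the order `M` of `α`,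
`ζ = α^{M/ℓ^r}`; for all `i`, `(ζ^i - 1)^k ∈ (α - 1)^k𝒪 ⊆ n𝒪`; hence
`ℓ^k = Φ_{ℓ^r}(1)^k = ∏_{i ∈ (ℤ/ℓ^r)^×} (1 - ζ^i)^k ∈ n^{φ(ℓ^r)}𝒪`; "`ℤ[1/n] ∩ 𝒪 = ℤ`" because no
prime dividing `n` is a unit in `𝒪` (`dvd_of_natCast_eq_mul`); so `n^{φ(ℓ^r)} ∣ ℓ^k`, `n` is a power
`ℓ^m` of `ℓ` and `mφ(ℓ^r) = m(ℓ - 1)ℓ^{r-1} ≤ k`. Proof of Theorem 6.2 over `ℤ` (the paper goes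
through Theorem 4.4; here through eigenvalues, which is the route of Remark 3.2): for an eigenvalue
`λ ∈ ℚ̄` of `A`, a root of unity, `(λ - 1)^k = nμ` with `μ` an eigenvalue of the INTEGER matrix
`B = (A - 1)^k/n`, so Corollary 3.3 in the domain `ℤ̄` of all algebraic integers gives
`λ^{R(k,n)} = 1`; then `A^{R(k,n)}` has all eigenvalues `1`, its eigenvalue group is trivial, so it
is neat, and a neat matrix of finite order is `1` (`NeatSubgroups.IsNeat.eq_one_of_pow_eq_one`).

## References

* [SilverbergZarhin1996] A. Silverberg, Yu. G. Zarhin, Variations on a theme of Minkowski and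
  Serre, J. Pure Appl. Algebra 111 (1996) 285–302: Def. 2.1, Thm. 3.1, Rem. 3.2, Cor. 3.3, Thm. 6.2.
* [Minkowski1887] H. Minkowski, J. reine angew. Math. 101 (1887), 196–202, §1.
-/

namespace Literature.GroupTheory.ArithmeticGroups

namespace SilverbergZarhin

open Polynomial Finset

/-! ### §1 The printed `N(k)` and `R(k, n)` -/

/-- **`N(k)`** ([SilverbergZarhin1996, Def. 2.1]): the prime powers `ℓ^m` with
`0 < m(ℓ - 1) ≤ k`, together with `1` (as in the printed examples `N(1) = {1, 2}`,
`N(2) = {1, 2, 3, 4}`). [cite: SilverbergZarhin1996, Def. 2.1] -/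
def exceptionalSet (k : ℕ) : Set ℕ :=
  {n | n = 1 ∨ ∃ ℓ m : ℕ, ℓ.Prime ∧ 0 < m ∧ m * (ℓ - 1) ≤ k ∧ n = ℓ ^ m}

/-- **`R(k, n)`** ([SilverbergZarhin1996, Def. 2.1]): `R(k, 1) = 0`; `R(k, n) = 1` for `n ∉ N(k)`;
and `R(k, ℓ^m) = ℓ^{r(k, ℓ^m)}`, `r(k, ℓ^m) = max{r ≥ 1 : m(ℓ - 1)ℓ^{r-1} ≤ k}`, for
`1 ≠ ℓ^m ∈ N(k)`. (Here `ℓ = minFac n`, `m = log_ℓ n`; the maximum is taken with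
`Nat.findGreatest` over `r ≤ k`, which contains every admissible `r` since `ℓ^{r-1} ≥ r`.)
[cite: SilverbergZarhin1996, Def. 2.1] -/
def orderBound (k n : ℕ) : ℕ :=
  if n = 1 then 0
  else if n.minFac ^ Nat.log n.minFac n = n ∧ Nat.log n.minFac n * (n.minFac - 1) ≤ k then
    n.minFac ^ Nat.findGreatest (fun r => Nat.log n.minFac n * (n.minFac - 1) * n.minFac ^ (r - 1) ≤ k) k
  else 1

/-- Unfolding of `N(k)`. [cite: SilverbergZarhin1996, Def. 2.1] -/
theorem mem_exceptionalSet_iff {k n : ℕ} :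
    n ∈ exceptionalSet k ↔ n = 1 ∨ ∃ ℓ m : ℕ, ℓ.Prime ∧ 0 < m ∧ m * (ℓ - 1) ≤ k ∧ n = ℓ ^ m :=
  Iff.rfl

/-! ### §2 "`ℤ[1/n] ∩ 𝒪 = ℤ`" -/

section Domain

variable {O : Type*} [CommRing O] [IsDomain O]

omit [IsDomain O] in
/-- Products whose factors are `q`-multiples are `q ^ (number of factors)`-multiples. [folklore] -/
private theorem exists_prod_eq_pow_mul {ι : Type*} (s : Finset ι) (f : ι → O) (q : O)
    (h : ∀ i ∈ s, ∃ w, f i = q * w) : ∃ w, ∏ i ∈ s, f i = q ^ s.card * w := by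
  classical
  induction s using Finset.induction_on with
  | empty => exact ⟨1, by simp⟩
  | insert a s ha ih =>
    obtain ⟨w₁, e₁⟩ := h a (Finset.mem_insert_self a s)
    obtain ⟨w₂, e₂⟩ := ih fun i hi => h i (Finset.mem_insert_of_mem hi)
    exact ⟨w₁ * w₂, by rw [Finset.prod_insert ha, Finset.card_insert_of_notMem ha, e₁, e₂]; ring⟩

variable [CharZero O]

/-- **"`ℤ[1/n] ∩ 𝒪 = ℤ`"** ([SilverbergZarhin1996, proof of Thm. 3.1, p. 287]): if no rational
prime dividing `b` is a unit in the characteristic-zero domain `𝒪` and `a = b·C` in `𝒪` for natural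
numbers `a`, `b ≠ 0`, then `b ∣ a`. ("If `β ∉ ℤ`, then we can write `β = a/(pb)` where `p` is a prime
dividing `n` but not dividing `a` … `1/p ∈ ℤ + ℤβ ⊆ 𝒪`, contradicting the assumption that no
rational prime which divides `n` is a unit in `𝒪`.") [cite: SilverbergZarhin1996, Thm. 3.1 proof p. 287] -/
theorem dvd_of_natCast_eq_mul {a b : ℕ} (hb : ∀ p : ℕ, p.Prime → p ∣ b → ¬ IsUnit (p : O))
    (hb0 : b ≠ 0) {C : O} (h : (a : O) = b * C) : b ∣ a := by
  set d := Nat.gcd a b with hd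
  have hdpos : 0 < d := Nat.gcd_pos_of_pos_right a (Nat.pos_of_ne_zero hb0)
  have ha : a / d * d = a := Nat.div_mul_cancel (Nat.gcd_dvd_left a b)
  have hb' : b / d * d = b := Nat.div_mul_cancel (Nat.gcd_dvd_right a b)
  have hcop : Nat.Coprime (a / d) (b / d) := Nat.coprime_div_gcd_div_gcd hdpos
  -- cancel `d`: `a/d = (b/d)·C` in `𝒪`
  have h' : ((a / d : ℕ) : O) = (b / d : ℕ) * C := by
    have hdO : (d : O) ≠ 0 := Nat.cast_ne_zero.2 hdpos.ne'
    apply mul_right_cancel₀ hdO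
    calc ((a / d : ℕ) : O) * d = ((a / d * d : ℕ) : O) := by push_cast; ring
      _ = (b : O) * C := by rw [ha, h]
      _ = ((b / d * d : ℕ) : O) * C := by rw [hb']
      _ = (b / d : ℕ) * C * d := by push_cast; ring
  -- Bezout: `b/d` is a unit of `𝒪`
  obtain ⟨u, v, huv⟩ := hcop.cast (R := O)
  have hunit : IsUnit ((b / d : ℕ) : O) :=
    IsUnit.of_mul_eq_one (u * C + v) (by linear_combination huv - u * h')
  -- so `b/d` has no prime factor, `b/d = 1`, `b = d ∣ a`
  by_cases h1 : b / d = 1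
  · rw [← hb', h1, one_mul]
    exact Nat.gcd_dvd_left a b
  · obtain ⟨p, hp, hpd⟩ := Nat.exists_prime_and_dvd h1
    have hpb : p ∣ b := hpd.trans (Nat.div_dvd_of_dvd (Nat.gcd_dvd_right a b))
    exact absurd (isUnit_of_dvd_unit (Nat.cast_dvd_cast hpd) hunit) (hb p hp hpb)

/-! ### §3 Corollary 3.3: roots of unity `α` with `(α - 1)^k ∈ n𝒪` -/

/-- **The structural content of [SilverbergZarhin1996, Thm. 3.1 / Cor. 3.3]** ("`n ∈ N(k)`. Further,
`n` is a power of every prime which divides the order of `α` … with `m(ℓ - 1)ℓ^{r-1} ≤ k`",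
p. 287): let `𝒪` be an integral domain of characteristic zero in which no rational prime dividing
`n ≠ 1` is a unit, `α ∈ 𝒪` of finite multiplicative order with `(α - 1)^k ∈ n𝒪`. If `ℓ^r`
(`ℓ` prime, `r ≥ 1`) divides the order of `α`, then `n = ℓ^m` with `m ≥ 1` and
`m(ℓ - 1)ℓ^{r-1} ≤ k`. [cite: SilverbergZarhin1996, Thm. 3.1 and Cor. 3.3] -/
theorem exists_eq_prime_pow_of_dvd_orderOf {n k : ℕ} (hn1 : n ≠ 1)
    (hn : ∀ p : ℕ, p.Prime → p ∣ n → ¬ IsUnit (p : O)) {α : O} (hα : IsOfFinOrder α)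
    (hcong : ∃ β : O, (α - 1) ^ k = n * β) {ℓ r : ℕ} (hℓ : ℓ.Prime) (hr : 0 < r)
    (hdvd : ℓ ^ r ∣ orderOf α) :
    ∃ m : ℕ, 0 < m ∧ n = ℓ ^ m ∧ m * (ℓ - 1) * ℓ ^ (r - 1) ≤ k := by
  classical
  obtain ⟨β, hβ⟩ := hcong
  have hM0 : orderOf α ≠ 0 := (orderOf_pos_iff.2 hα).ne'
  -- the degenerate case `n = 0`: then `α = 1`
  rcases Nat.eq_zero_or_pos n with rfl | hnpos
  · exfalso
    rw [Nat.cast_zero, zero_mul, pow_eq_zero_iff', sub_eq_zero] at hβ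
    have h1 : orderOf α = 1 := by rw [hβ.1, orderOf_one]
    rw [h1, Nat.dvd_one] at hdvd
    rcases Nat.pow_eq_one.1 hdvd with h | h
    · exact hℓ.one_lt.ne' h
    · exact hr.ne' h
  -- `ζ = α^{M/ℓ^r}` has order `ℓ^r`
  set ζ := α ^ (orderOf α / ℓ ^ r) with hζdef
  have hζord : orderOf ζ = ℓ ^ r := orderOf_pow_orderOf_div hM0 hdvd
  have hζ : IsPrimitiveRoot ζ (ℓ ^ r) := by rw [← hζord]; exact IsPrimitiveRoot.orderOf ζ
  -- `(1 - α^j)^k ∈ n𝒪` for every `j`, hence `(1 - ζ^i)^k ∈ n𝒪`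
  have hcong' : ∀ j : ℕ, ∃ c : O, (1 - α ^ j) ^ k = n * c := fun j => by
    refine ⟨β * (-(∑ i ∈ Finset.range j, α ^ i)) ^ k, ?_⟩
    have e : 1 - α ^ j = (α - 1) * (-(∑ i ∈ Finset.range j, α ^ i)) := by
      rw [← mul_neg_geom_sum]; ring
    rw [e, mul_pow, hβ, mul_assoc]
  have hζi : ∀ i : ℕ, ∃ c : O, (1 - ζ ^ i) ^ k = n * c := fun i => by
    rw [hζdef, ← pow_mul]
    exact hcong' _
  -- `ℓ = Φ_{ℓ^r}(1) = ∏ (1 - μ)` over the primitive `ℓ^r`-th roots of unity `μ = ζ^i`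
  obtain ⟨r', rfl⟩ : ∃ r', r = r' + 1 := ⟨r - 1, by omega⟩
  haveI := Fact.mk hℓ
  haveI : NeZero (ℓ ^ (r' + 1)) := ⟨pow_ne_zero _ hℓ.ne_zero⟩
  have hprod : (ℓ : O) = ∏ μ ∈ primitiveRoots (ℓ ^ (r' + 1)) O, (1 - μ) := by
    have h := Polynomial.eval_one_cyclotomic_prime_pow (R := O) (p := ℓ) r'
    rw [Polynomial.cyclotomic_eq_prod_X_sub_primitiveRoots hζ, Polynomial.eval_prod] at h
    simp only [eval_sub, eval_X, eval_C] at h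
    exact h.symm
  have hfac : ∀ μ ∈ primitiveRoots (ℓ ^ (r' + 1)) O, ∃ c : O, (1 - μ) ^ k = n * c := by
    intro μ hμ
    have hμ' : IsPrimitiveRoot μ (ℓ ^ (r' + 1)) := (mem_primitiveRoots (NeZero.pos _)).1 hμ
    obtain ⟨i, -, rfl⟩ := hζ.eq_pow_of_pow_eq_one hμ'.pow_eq_one
    exact hζi i
  obtain ⟨C, hC⟩ := exists_prod_eq_pow_mul _ (fun μ => (1 - μ) ^ k) (n : O) hfac
  rw [Finset.prod_pow, ← hprod, hζ.card_primitiveRoots] at hC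
  -- `n^{φ(ℓ^r)} ∣ ℓ^k` in `ℕ`, by "`ℤ[1/n] ∩ 𝒪 = ℤ`"
  have hdiv : n ^ Nat.totient (ℓ ^ (r' + 1)) ∣ ℓ ^ k :=
    dvd_of_natCast_eq_mul (O := O) (fun p hp hpd => hn p hp (hp.dvd_of_dvd_pow hpd))
      (pow_ne_zero _ hnpos.ne') (C := C) (by exact_mod_cast hC)
  have hφ : Nat.totient (ℓ ^ (r' + 1)) = ℓ ^ r' * (ℓ - 1) := by
    rw [Nat.totient_prime_pow hℓ (Nat.succ_pos r'), Nat.succ_sub_one]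
  have hφpos : 0 < Nat.totient (ℓ ^ (r' + 1)) := Nat.totient_pos.2 (NeZero.pos _)
  -- `n ∣ ℓ^k`, so `n = ℓ^m`, `m ≥ 1`
  obtain ⟨m, -, hnm⟩ := (Nat.dvd_prime_pow hℓ).1 ((dvd_pow_self n hφpos.ne').trans hdiv)
  have hm0 : 0 < m := by
    rcases Nat.eq_zero_or_pos m with h0 | h0
    · rw [h0, pow_zero] at hnm
      exact absurd hnm hn1
    · exact h0
  refine ⟨m, hm0, hnm, ?_⟩
  rw [hnm, ← pow_mul, Nat.pow_dvd_pow_iff_le_right hℓ.one_lt, hφ] at hdiv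
  rw [Nat.add_sub_cancel, show m * (ℓ - 1) * ℓ ^ r' = m * (ℓ ^ r' * (ℓ - 1)) by ring]
  exact hdiv

/-- **"The order of `α` is a prime power `ℓ^r`"** ([SilverbergZarhin1996, proof of Thm. 3.1,
p. 287]): under the hypotheses of Corollary 3.3 (`n ≠ 1`), the order of `α` is `1` or a power of a
single prime `ℓ`, and then `n` is a power of the same `ℓ`. [cite: SilverbergZarhin1996, Thm. 3.1 proof p. 287] -/
theorem eq_of_prime_dvd_orderOf {n k : ℕ} (hn1 : n ≠ 1)
    (hn : ∀ p : ℕ, p.Prime → p ∣ n → ¬ IsUnit (p : O)) {α : O} (hα : IsOfFinOrder α)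
    (hcong : ∃ β : O, (α - 1) ^ k = n * β) {ℓ ℓ' : ℕ} (hℓ : ℓ.Prime) (hℓ' : ℓ'.Prime)
    (hdvd : ℓ ∣ orderOf α) (hdvd' : ℓ' ∣ orderOf α) : ℓ = ℓ' := by
  obtain ⟨m, hm, hnm, -⟩ := exists_eq_prime_pow_of_dvd_orderOf hn1 hn hα hcong hℓ Nat.one_pos
    (by rwa [pow_one])
  obtain ⟨m', hm', hnm', -⟩ := exists_eq_prime_pow_of_dvd_orderOf hn1 hn hα hcong hℓ' Nat.one_pos
    (by rwa [pow_one])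
  have h : ℓ ∣ ℓ' ^ m' := by rw [← hnm', hnm]; exact dvd_pow_self ℓ hm.ne'
  exact (Nat.prime_dvd_prime_iff_eq hℓ hℓ').1 (hℓ.dvd_of_dvd_pow h)

/-- **Corollary 3.3, "in particular" clause** ([SilverbergZarhin1996, Cor. 3.3]): "`α = 1` if
`n ∉ N(k)`". [cite: SilverbergZarhin1996, Cor. 3.3] -/
theorem eq_one_of_not_mem_exceptionalSet {n k : ℕ} (hnN : n ∉ exceptionalSet k)
    (hn : ∀ p : ℕ, p.Prime → p ∣ n → ¬ IsUnit (p : O)) {α : O} (hα : IsOfFinOrder α)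
    (hcong : ∃ β : O, (α - 1) ^ k = n * β) : α = 1 := by
  rw [mem_exceptionalSet_iff, not_or] at hnN
  by_contra hne
  have hord1 : orderOf α ≠ 1 := fun h => hne (orderOf_eq_one_iff.1 h)
  obtain ⟨ℓ, hℓ, hℓdvd⟩ := Nat.exists_prime_and_dvd hord1
  obtain ⟨m, hm, hnm, hle⟩ := exists_eq_prime_pow_of_dvd_orderOf hnN.1 hn hα hcong hℓ Nat.one_pos
    (by rwa [pow_one])
  refine hnN.2 ⟨ℓ, m, hℓ, hm, ?_, hnm⟩
  simpa using hle

/-- **The case `k = 1`, `n ≥ 3` (Serre–Minkowski for roots of unity)**: "if `n ≥ 3` then every root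
of unity which is congruent to `1` modulo `n` is `1`" ([SilverbergZarhin1996, §1]) — in any
characteristic-zero domain in which no prime dividing `n` is a unit (`N(1) = {1, 2}`).
[cite: SilverbergZarhin1996, §1 and Cor. 3.3 (k = 1)] -/
theorem eq_one_of_sub_one_mem {n : ℕ} (h3 : 3 ≤ n)
    (hn : ∀ p : ℕ, p.Prime → p ∣ n → ¬ IsUnit (p : O)) {α : O} (hα : IsOfFinOrder α)
    (hcong : ∃ β : O, α - 1 = n * β) : α = 1 := by
  refine eq_one_of_not_mem_exceptionalSet (k := 1) ?_ hn hα (by simpa using hcong)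
  rintro (h1 | ⟨ℓ, m, hℓ, hm, hle, hnm⟩)
  · omega
  · -- `m(ℓ - 1) ≤ 1` forces `ℓ = 2`, `m = 1`, `n = 2`
    have hℓ2 := hℓ.two_le
    have hl1 : ℓ - 1 ≤ 1 := le_trans (Nat.le_mul_of_pos_left _ hm) hle
    have hℓeq : ℓ = 2 := by omega
    subst hℓeq
    have hm1 : m = 1 := by
      have : m * 1 ≤ 1 := by simpa using hle
      omega
    subst hm1
    simp at hnm
    omega

/-- **The case `k = 1`, `n = 2`**: a root of unity `α` with `α ≡ 1 (mod 2)` satisfies `α² = 1`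
(`R(1, 2) = 2`, [SilverbergZarhin1996, p. 287]). [cite: SilverbergZarhin1996, Cor. 3.3 (k = 1, n = 2)] -/
theorem sq_eq_one_of_sub_one_mem_two (hn : ¬ IsUnit (2 : O)) {α : O} (hα : IsOfFinOrder α)
    (hcong : ∃ β : O, α - 1 = 2 * β) : α ^ 2 = 1 := by
  have hn' : ∀ p : ℕ, p.Prime → p ∣ 2 → ¬ IsUnit (p : O) := by
    intro p hp hp2
    rw [(Nat.prime_dvd_prime_iff_eq hp Nat.prime_two).1 hp2, Nat.cast_ofNat]
    exact hn
  have hcong' : ∃ β : O, (α - 1) ^ 1 = (2 : ℕ) * β := by simpa using hcong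
  -- the order of `α` is a power of `2` …
  have hM0 : orderOf α ≠ 0 := (orderOf_pos_iff.2 hα).ne'
  have h2pow : ∃ r, orderOf α = 2 ^ r := by
    refine ⟨_, Nat.eq_prime_pow_of_unique_prime_dvd hM0 fun {p} hp hpd => ?_⟩
    by_contra hne
    obtain ⟨m, hm, hnm, -⟩ := exists_eq_prime_pow_of_dvd_orderOf (by norm_num) hn' hα hcong' hp
      Nat.one_pos (by rwa [pow_one])
    have : p ∣ 2 := by rw [hnm]; exact dvd_pow_self p hm.ne'
    exact hne ((Nat.prime_dvd_prime_iff_eq hp Nat.prime_two).1 this)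
  -- … and `4` does not divide it (`1·(2-1)·2^{2-1} = 2 > 1`)
  obtain ⟨r, hr⟩ := h2pow
  have hr1 : r ≤ 1 := by
    by_contra hr1
    have h4 : 2 ^ 2 ∣ orderOf α := by rw [hr]; exact Nat.pow_dvd_pow 2 (by omega)
    obtain ⟨m, hm, hnm, hle⟩ := exists_eq_prime_pow_of_dvd_orderOf (by norm_num) hn' hα hcong'
      Nat.prime_two (by norm_num) h4
    have hm1 : m = 1 := by
      have := Nat.pow_right_injective le_rfl (hnm.symm.trans (pow_one 2).symm)
      simpa using this
    subst hm1
    norm_num at hle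
  have hdvd : orderOf α ∣ 2 := by
    rw [hr]
    exact Nat.pow_dvd_pow 2 hr1 |>.trans (by norm_num)
  exact orderOf_dvd_iff_pow_eq_one.1 hdvd


/-! ### §4 `α ^ R(k, n) = 1` -/

/-- `R(k, 1) = 0`. [cite: SilverbergZarhin1996, Def. 2.1] -/
theorem orderBound_one (k : ℕ) : orderBound k 1 = 0 := by
  simp [orderBound]

/-- `R(k, ℓ^m) = ℓ^{r(k, ℓ^m)}` for `ℓ^m ∈ N(k)`, `m ≥ 1`. [cite: SilverbergZarhin1996, Def. 2.1] -/
theorem orderBound_prime_pow {k ℓ m : ℕ} (hℓ : ℓ.Prime) (hm : 0 < m) (hle : m * (ℓ - 1) ≤ k) :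
    orderBound k (ℓ ^ m) =
      ℓ ^ Nat.findGreatest (fun r => m * (ℓ - 1) * ℓ ^ (r - 1) ≤ k) k := by
  have h1 : ℓ ^ m ≠ 1 := (Nat.one_lt_pow hm.ne' hℓ.one_lt).ne'
  have hmin : (ℓ ^ m).minFac = ℓ := hℓ.pow_minFac hm.ne'
  have hlog : Nat.log ℓ (ℓ ^ m) = m := Nat.log_pow hℓ.one_lt m
  rw [orderBound, if_neg h1, hmin, hlog, if_pos ⟨rfl, hle⟩]

/-- `R(k, n) = 1` for `n ∉ N(k)`. [cite: SilverbergZarhin1996, Def. 2.1] -/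
theorem orderBound_of_not_mem {k n : ℕ} (hnN : n ∉ exceptionalSet k) : orderBound k n = 1 := by
  rw [mem_exceptionalSet_iff, not_or] at hnN
  rw [orderBound, if_neg hnN.1, if_neg]
  rintro ⟨hpow, hle⟩
  refine hnN.2 ⟨n.minFac, Nat.log n.minFac n, Nat.minFac_prime hnN.1, ?_, hle, hpow.symm⟩
  rcases Nat.eq_zero_or_pos (Nat.log n.minFac n) with h0 | h0
  · rw [h0, pow_zero] at hpow
    exact absurd hpow.symm hnN.1
  · exact h0

omit [IsDomain O] [CharZero O] in
/-- For `ℓ ≥ 2` and `r ≥ 1`, `r ≤ ℓ ^ (r - 1) ≤ m(ℓ - 1)ℓ^{r-1}` when `m ≥ 1`; so an admissible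
`r` is at most `k`. [folklore] -/
private theorem le_of_admissible {ℓ m r k : ℕ} (hℓ : ℓ.Prime) (hm : 0 < m) (hr : 0 < r)
    (h : m * (ℓ - 1) * ℓ ^ (r - 1) ≤ k) : r ≤ k := by
  have h2 : 2 ^ (r - 1) ≤ ℓ ^ (r - 1) := Nat.pow_le_pow_left hℓ.two_le _
  have h3 : r - 1 < 2 ^ (r - 1) := Nat.lt_pow_self (by norm_num)
  have h4 : ℓ ^ (r - 1) ≤ m * (ℓ - 1) * ℓ ^ (r - 1) :=
    Nat.le_mul_of_pos_left _ (Nat.mul_pos hm (by have := hℓ.two_le; omega))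
  omega

/-- **Corollary 3.3** ([SilverbergZarhin1996]), order form: under its hypotheses the order of `α`
divides `R(k, n)`. [cite: SilverbergZarhin1996, Cor. 3.3] -/
theorem orderOf_dvd_orderBound {n k : ℕ} (hn : ∀ p : ℕ, p.Prime → p ∣ n → ¬ IsUnit (p : O))
    {α : O} (hα : IsOfFinOrder α) (hcong : ∃ β : O, (α - 1) ^ k = n * β) :
    orderOf α ∣ orderBound k n := by
  rcases eq_or_ne n 1 with rfl | hn1
  · rw [orderBound_one]
    exact dvd_zero _
  by_cases hnN : n ∈ exceptionalSet k
  · obtain ⟨ℓ, m, hℓ, hm, hle, rfl⟩ := hnN.resolve_left hn1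
    rw [orderBound_prime_pow hℓ hm hle]
    have hM0 : orderOf α ≠ 0 := (orderOf_pos_iff.2 hα).ne'
    -- the order of `α` is a power `ℓ^e` of `ℓ`
    have hpow := Nat.eq_prime_pow_of_unique_prime_dvd hM0 (p := ℓ) fun {p} hp hpd => by
      obtain ⟨m', hm', hnm', -⟩ := exists_eq_prime_pow_of_dvd_orderOf hn1 hn hα hcong hp
        Nat.one_pos (by rwa [pow_one])
      have h : p ∣ ℓ ^ m := by rw [hnm']; exact dvd_pow_self p hm'.ne'
      exact (Nat.prime_dvd_prime_iff_eq hp hℓ).1 (hp.dvd_of_dvd_pow h)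
    set e := (orderOf α).primeFactorsList.length with he
    rw [hpow]
    apply Nat.pow_dvd_pow ℓ
    rcases Nat.eq_zero_or_pos e with h0 | hepos
    · rw [h0]
      exact Nat.zero_le _
    · obtain ⟨m', hm', hnm', hle'⟩ :=
        exists_eq_prime_pow_of_dvd_orderOf hn1 hn hα hcong hℓ hepos (hpow ▸ dvd_rfl)
      have hmm : m = m' := Nat.pow_right_injective hℓ.two_le hnm'
      subst hmm
      exact Nat.le_findGreatest (le_of_admissible hℓ hm hepos hle') hle'
  · rw [orderBound_of_not_mem hnN, eq_one_of_not_mem_exceptionalSet hnN hn hα hcong, orderOf_one]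

/-- **Corollary 3.3** ([SilverbergZarhin1996, p. 288]): "Suppose `n` and `k` are positive integers,
`𝒪` is an integral domain of characteristic zero such that no rational prime which divides `n` is a
unit in `𝒪`, `α ∈ 𝒪`, `α` has finite multiplicative order, and `(α - 1)^k ∈ n𝒪`. Then
`α^{R(k,n)} = 1`." [cite: SilverbergZarhin1996, Cor. 3.3] -/
theorem pow_orderBound_eq_one {n k : ℕ} (hn : ∀ p : ℕ, p.Prime → p ∣ n → ¬ IsUnit (p : O))
    {α : O} (hα : IsOfFinOrder α) (hcong : ∃ β : O, (α - 1) ^ k = n * β) :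
    α ^ orderBound k n = 1 :=
  orderOf_dvd_iff_pow_eq_one.1 (orderOf_dvd_orderBound hn hα hcong)

end Domain

/-! ### §5 The printed values of `R(k, n)` for `k ≤ 2` -/

/-- `R(1, 2) = 2`. [cite: SilverbergZarhin1996, §2 p. 287] -/
theorem orderBound_one_two : orderBound 1 2 = 2 := by
  rw [show (2 : ℕ) = 2 ^ 1 from rfl, orderBound_prime_pow Nat.prime_two Nat.one_pos (by norm_num)]
  decide

/-- `R(1, n) = 1` if `n ≥ 3`. [cite: SilverbergZarhin1996, §2 p. 287] -/
theorem orderBound_one_of_three_le {n : ℕ} (hn : 3 ≤ n) : orderBound 1 n = 1 := by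
  refine orderBound_of_not_mem ?_
  rintro (h1 | ⟨ℓ, m, hℓ, hm, hle, rfl⟩)
  · omega
  · have hℓ2 := hℓ.two_le
    have hl1 : ℓ - 1 ≤ 1 := le_trans (Nat.le_mul_of_pos_left _ hm) hle
    have hℓeq : ℓ = 2 := by omega
    subst hℓeq
    have hm1 : m = 1 := by
      have : m * 1 ≤ 1 := by simpa using hle
      omega
    subst hm1
    norm_num at hn

/-- `R(2, 2) = 4`. [cite: SilverbergZarhin1996, §2 p. 287] -/
theorem orderBound_two_two : orderBound 2 2 = 4 := by
  rw [show (2 : ℕ) = 2 ^ 1 from rfl, orderBound_prime_pow Nat.prime_two Nat.one_pos (by norm_num)]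
  decide

/-- `R(2, 3) = 3`. [cite: SilverbergZarhin1996, §2 p. 287] -/
theorem orderBound_two_three : orderBound 2 3 = 3 := by
  rw [show (3 : ℕ) = 3 ^ 1 from rfl, orderBound_prime_pow Nat.prime_three Nat.one_pos (by norm_num)]
  decide

/-- `R(2, 4) = 2`. [cite: SilverbergZarhin1996, §2 p. 287] -/
theorem orderBound_two_four : orderBound 2 4 = 2 := by
  rw [show (4 : ℕ) = 2 ^ 2 by norm_num, orderBound_prime_pow Nat.prime_two (by norm_num) (by norm_num)]
  decide

/-- `R(2, n) = 1` if `n ≥ 5`. [cite: SilverbergZarhin1996, §2 p. 287] -/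
theorem orderBound_two_of_five_le {n : ℕ} (hn : 5 ≤ n) : orderBound 2 n = 1 := by
  refine orderBound_of_not_mem ?_
  rintro (h1 | ⟨ℓ, m, hℓ, hm, hle, rfl⟩)
  · omega
  · -- `m(ℓ - 1) ≤ 2` with `ℓ^m ≥ 5`: impossible
    have hℓ2 := hℓ.two_le
    have hl1 : ℓ - 1 ≤ 2 := le_trans (Nat.le_mul_of_pos_left _ hm) hle
    have hl3 : ℓ ≤ 3 := by omega
    interval_cases ℓ
    · -- ℓ = 2: m ≤ 2, 2^m ≥ 5 impossible
      have hm2 : m ≤ 2 := by simpa using hle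
      interval_cases m <;> norm_num at hn
    · -- ℓ = 3: m ≤ 1
      have hm1 : m ≤ 1 := by omega
      interval_cases m; norm_num at hn

/-! ### §6 Theorem 6.2 over `ℤ`: periodic integral matrices with `(A - 1)^k ∈ n M_g(ℤ)` -/

section Matrix

variable {L : Type*} [Field L]
variable {ι : Type*} [Fintype ι] [DecidableEq ι]

/-- The eigenvalues of a matrix of finite order are roots of unity (`det(x - G) = 0 ⟹
det(x^N - G^N) = 0`). [folklore] -/
private theorem pow_eq_one_of_isRoot_charpoly {G : Matrix ι ι L} {N : ℕ} (hG : G ^ N = 1) {x : L}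
    (hx : G.charpoly.IsRoot x) : x ^ N = 1 := by
  rw [Polynomial.IsRoot.def, Matrix.eval_charpoly] at hx
  have hcomm : Commute (Matrix.scalar ι x) G := Matrix.scalar_commute x (fun r' => Commute.all x r') G
  have h := congr_arg Matrix.det (hcomm.geom_sum₂_mul N)
  rw [Matrix.det_mul, hx, mul_zero, hG, ← map_pow, ← map_one (Matrix.scalar ι), ← map_sub,
    Matrix.scalar_apply, Matrix.det_diagonal, Finset.prod_const, Finset.card_univ] at h
  rcases Nat.eq_zero_or_pos (Fintype.card ι) with hc | hc
  · rw [hc, pow_zero] at h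
    exact absurd h zero_ne_one
  · exact sub_eq_zero.1 ((pow_eq_zero_iff hc.ne').1 h.symm)

/-- If `x` is an eigenvalue of `G` and `(G - 1)^k = n·B`, then `(x - 1)^k = nμ` for an eigenvalue
`μ` of `B` (`det((x-1)^k - (G-1)^k) = 0` since `x - 1` is an eigenvalue of `G - 1`); for `n = 0`,
`(x - 1)^k = 0`. In either case `(x - 1)^k = nμ` with `μ` integral when `B` is. [folklore] -/
private theorem exists_pow_sub_one_eq_mul [CharZero L] {G B : Matrix ι ι L} {k n : ℕ}
    (hGB : (G - 1) ^ k = (n : L) • B) (hB : ∀ i j, IsIntegral ℤ (B i j)) {x : L}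
    (hx : G.charpoly.IsRoot x) : ∃ μ : L, IsIntegral ℤ μ ∧ (x - 1) ^ k = n * μ := by
  rw [Polynomial.IsRoot.def, Matrix.eval_charpoly] at hx
  -- `det (scalar ((x-1)^k) - (G - 1)^k) = 0`
  have hcomm : Commute (Matrix.scalar ι (x - 1)) (G - 1) :=
    Matrix.scalar_commute (x - 1) (fun r' => Commute.all _ r') _
  have h := congr_arg Matrix.det (hcomm.geom_sum₂_mul k)
  have hx' : (Matrix.scalar ι (x - 1) - (G - 1)).det = 0 := by
    rw [map_sub, map_one, sub_sub_sub_cancel_right]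
    exact hx
  rw [Matrix.det_mul, hx', mul_zero, ← map_pow, hGB] at h
  -- `h : 0 = det (scalar ((x - 1)^k) - n • B)`
  rcases Nat.eq_zero_or_pos n with rfl | hn
  · refine ⟨0, isIntegral_zero, ?_⟩
    rw [Nat.cast_zero, zero_smul, sub_zero, Matrix.scalar_apply, Matrix.det_diagonal,
      Finset.prod_const, Finset.card_univ] at h
    rw [Nat.cast_zero, zero_mul]
    rcases Nat.eq_zero_or_pos (Fintype.card ι) with hc | hc
    · rw [hc, pow_zero] at h
      exact absurd h zero_ne_one
    · exact (pow_eq_zero_iff hc.ne').1 h.symm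
  · have hnL : (n : L) ≠ 0 := Nat.cast_ne_zero.2 hn.ne'
    set μ := (x - 1) ^ k / n with hμ
    have hnμ : (n : L) * μ = (x - 1) ^ k := by rw [hμ]; exact mul_div_cancel₀ _ hnL
    refine ⟨μ, isIntegral_of_isRoot_charpoly hB ?_, hnμ.symm⟩
    rw [Polynomial.IsRoot.def, Matrix.eval_charpoly]
    have e : Matrix.scalar ι ((x - 1) ^ k) - (n : L) • B = (n : L) • (Matrix.scalar ι μ - B) := by
      ext i j
      simp only [Matrix.sub_apply, Matrix.scalar_apply, Matrix.diagonal_apply, Matrix.smul_apply,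
        smul_eq_mul, mul_sub]
      split_ifs
      · rw [hnμ]
      · simp
    rw [e, Matrix.det_smul] at h
    exact (mul_eq_zero.1 h.symm).resolve_left (pow_ne_zero _ hnL)

/-- Over an algebraically closed field an eigenvalue of `G ^ R` (`R ≥ 1`) is `x ^ R` for an
eigenvalue `x` of `G`: `X^R - y = ∏ (X - xᵢ)`, so `det(G^R - y) = ∏ det(G - xᵢ)`. [folklore] -/
private theorem exists_isRoot_charpoly_of_pow [IsAlgClosed L] {G : Matrix ι ι L} {R : ℕ}
    (hR : 0 < R) {y : L} (hy : (G ^ R).charpoly.IsRoot y) :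
    ∃ x : L, G.charpoly.IsRoot x ∧ x ^ R = y := by
  classical
  set p : L[X] := X ^ R - C y with hp
  have hmonic : p.Monic := monic_X_pow_sub_C y hR.ne'
  have hprod := (IsAlgClosed.splits p).eq_prod_roots_of_monic hmonic
  have hGp : aeval G p = G ^ R - Matrix.scalar ι y := by
    rw [hp, map_sub, map_pow, aeval_X, aeval_C]
    rfl
  have hdet : (aeval G p).det = 0 := by
    rw [Polynomial.IsRoot.def, Matrix.eval_charpoly] at hy
    rw [hGp, ← neg_sub, Matrix.det_neg, hy, mul_zero]
  rw [hprod, ← Multiset.coe_toList p.roots, Multiset.map_coe, Multiset.prod_coe, map_list_prod,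
    List.map_map, ← Matrix.coe_detMonoidHom, map_list_prod, List.map_map, List.prod_eq_zero_iff,
    List.mem_map] at hdet
  obtain ⟨x, hx, hx0⟩ := hdet
  rw [Multiset.mem_toList] at hx
  refine ⟨x, ?_, ?_⟩
  · simp only [Function.comp_apply, Matrix.coe_detMonoidHom, map_sub, aeval_X, aeval_C] at hx0
    rw [Polynomial.IsRoot.def, Matrix.eval_charpoly, ← neg_sub, Matrix.det_neg]
    have : (G - Matrix.scalar ι x).det = 0 := hx0
    rw [this, mul_zero]
  · have := (Polynomial.mem_roots hmonic.ne_zero).1 hx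
    rw [Polynomial.IsRoot.def, hp, eval_sub, eval_pow, eval_X, eval_C, sub_eq_zero] at this
    exact this

/-- A rational prime is not a unit in the ring `ℤ̄ ∩ L` of algebraic integers of a field `L` of
characteristic zero (`1/p` is not an algebraic integer, `ℤ` being integrally closed). [folklore] -/
private theorem not_isUnit_natCast_integralClosure [CharZero L] {p : ℕ} (hp : p.Prime) :
    ¬ IsUnit ((p : integralClosure ℤ L)) := by
  rintro ⟨u, hu⟩
  set v : L := (((u⁻¹ : (integralClosure ℤ L)ˣ) : integralClosure ℤ L) : L) with hvdef
  -- `p · v = 1` in `L`, and `v` is an algebraic integer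
  have hv : (p : L) * v = 1 := by
    have h := congr_arg (fun z : integralClosure ℤ L => (z : L)) u.mul_inv
    simpa [hu, hvdef] using h
  have hvint : IsIntegral ℤ v := (mem_integralClosure_iff ℤ L).1 (SetLike.coe_mem _)
  -- so `1/p ∈ ℚ` is integral over `ℤ`, i.e. an integer
  have hvq : v = algebraMap ℚ L ((p : ℚ)⁻¹) := by
    rw [map_inv₀, map_natCast]
    exact eq_inv_of_mul_eq_one_right hv
  have hint : IsIntegral ℤ ((p : ℚ)⁻¹) :=
    (isIntegral_algHom_iff (algebraMap ℚ L).toIntAlgHom (algebraMap ℚ L).injective).1 (hvq ▸ hvint)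
  obtain ⟨y, hy⟩ := IsIntegrallyClosed.isIntegral_iff.1 hint
  have hy' : (y : ℚ) * p = 1 := by
    have h : (y : ℚ) = (p : ℚ)⁻¹ := by simpa using hy
    rw [h, inv_mul_cancel₀ (Nat.cast_ne_zero.2 hp.ne_zero)]
  have hyp : y * (p : ℤ) = 1 := by exact_mod_cast hy'
  have hp1 : (p : ℤ) ∣ 1 := ⟨y, by rw [mul_comm]; exact hyp.symm⟩
  have : p = 1 := by exact_mod_cast Int.eq_one_of_dvd_one (Int.natCast_nonneg p) hp1
  exact hp.one_lt.ne' this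

/-- Theorem 6.2 over `ℤ`, with the auxiliary algebraically closed field `L` explicit. [cite: SilverbergZarhin1996, Thm. 6.2] -/
private theorem matrix_pow_orderBound_eq_one_aux (L : Type*) [Field L] [IsAlgClosed L]
    [CharZero L] {A : Matrix ι ι ℤ} (hA : IsOfFinOrder A) {n k : ℕ}
    {B : Matrix ι ι ℤ} (hcong : (A - 1) ^ k = (n : ℤ) • B) : A ^ orderBound k n = 1 := by
  classical
  rcases Nat.eq_zero_or_pos (orderBound k n) with h0 | hRpos
  · rw [h0, pow_zero]
  set R := orderBound k n with hRdef
  obtain ⟨N, hN, hAN⟩ := isOfFinOrder_iff_pow_eq_one.1 hA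
  set G : Matrix ι ι L := A.map (algebraMap ℤ L) with hGdef
  have hGN : G ^ N = 1 := by
    rw [hGdef, ← RingHom.mapMatrix_apply, ← map_pow, hAN, map_one]
  have hGB : (G - 1) ^ k = (n : L) • B.map (algebraMap ℤ L) := by
    have h := congr_arg (algebraMap ℤ L).mapMatrix hcong
    rw [map_pow, map_sub, map_one, map_zsmul, RingHom.mapMatrix_apply, RingHom.mapMatrix_apply] at h
    rw [hGdef, h, Nat.cast_smul_eq_nsmul, Nat.cast_smul_eq_nsmul]
  have hBint : ∀ i j, IsIntegral ℤ (B.map (algebraMap ℤ L) i j) := fun i j =>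
    isIntegral_algebraMap
  -- every eigenvalue `x` of `A` satisfies `x ^ R = 1`
  have hroots : ∀ x : L, G.charpoly.IsRoot x → x ^ R = 1 := by
    intro x hx
    have hxN : x ^ N = 1 := pow_eq_one_of_isRoot_charpoly hGN hx
    obtain ⟨μ, hμint, hμ⟩ := exists_pow_sub_one_eq_mul hGB hBint hx
    -- Corollary 3.3 in `𝒪 = ℤ̄ ∩ L`
    have hxint : IsIntegral ℤ x := ⟨X ^ N - 1, monic_X_pow_sub_C 1 hN.ne', by simp [hxN]⟩
    set a : integralClosure ℤ L := ⟨x, (mem_integralClosure_iff ℤ L).2 hxint⟩ with hadef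
    have ha : IsOfFinOrder a :=
      isOfFinOrder_iff_pow_eq_one.2 ⟨N, hN, Subtype.ext (by simp [hadef, hxN])⟩
    have hcong' : ∃ β : integralClosure ℤ L, (a - 1) ^ k = n * β :=
      ⟨⟨μ, (mem_integralClosure_iff ℤ L).2 hμint⟩, Subtype.ext (by simp [hadef, hμ])⟩
    have h := pow_orderBound_eq_one (O := integralClosure ℤ L) (k := k)
      (fun p hp _ => not_isUnit_natCast_integralClosure hp) ha hcong'
    simpa [hadef] using congr_arg Subtype.val h
  -- hence every eigenvalue of `A ^ R` is `1`: its eigenvalue group is trivial and `A ^ R` is neat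
  have hneat : IsNeat L (A ^ R) := by
    have hbot : eigenvalueSubgroup L (A ^ R) = ⊥ := by
      rw [eigenvalueSubgroup, Subgroup.closure_eq_bot_iff]
      intro u hu
      rw [Set.mem_setOf_eq, ← Matrix.charpoly_map,
        Polynomial.mem_roots (Matrix.charpoly_monic _).ne_zero] at hu
      have hmap : (A ^ R).map (algebraMap ℤ L) = G ^ R := by
        rw [hGdef, ← RingHom.mapMatrix_apply, ← RingHom.mapMatrix_apply, map_pow]
      rw [hmap] at hu
      obtain ⟨x, hx, hxu⟩ := exists_isRoot_charpoly_of_pow hRpos hu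
      rw [Set.mem_singleton_iff, ← Units.val_eq_one, ← hxu]
      exact hroots x hx
    intro u hu _
    rw [hbot] at hu
    exact (Subgroup.mem_bot).1 hu
  have hfin : (A ^ R) ^ N = 1 := by rw [← pow_mul, mul_comm, pow_mul, hAN, one_pow]
  exact hneat.eq_one_of_pow_eq_one (algebraMap ℤ L).injective_int hN hfin

/-- **Theorem 6.2 over `ℤ`** ([SilverbergZarhin1996, Thm. 6.2], `𝒪 = ℤ`): "If `A ∈ M_g(ℤ)` is a
matrix of finite multiplicative order such that `(A - I)^k ∈ nM_g(ℤ)`, then `A^{R(k,n)} = I`."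
(Via eigenvalues: each eigenvalue `λ ∈ ℚ̄` is a root of unity with `(λ - 1)^k = nμ`, `μ` an
algebraic integer, so `λ^{R(k,n)} = 1` by Corollary 3.3 in `ℤ̄`; a matrix of finite order all of
whose eigenvalues are `1` is neat with trivial eigenvalue group, hence `= 1`.)
[cite: SilverbergZarhin1996, Thm. 6.2] -/
theorem matrix_pow_orderBound_eq_one {A : Matrix ι ι ℤ} (hA : IsOfFinOrder A) {n k : ℕ}
    {B : Matrix ι ι ℤ} (hcong : (A - 1) ^ k = (n : ℤ) • B) : A ^ orderBound k n = 1 :=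
  haveI : CharZero (AlgebraicClosure ℚ) :=
    charZero_of_injective_algebraMap (algebraMap ℚ (AlgebraicClosure ℚ)).injective
  matrix_pow_orderBound_eq_one_aux (AlgebraicClosure ℚ) hA hcong

/-- **Theorem 6.2 over `ℤ`, "in particular"**: a periodic integral matrix `A` with
`(A - 1)^k ∈ n M_g(ℤ)` and `n ∉ N(k)` is the identity (e.g. `k = 2`, `n ≥ 5`).
[cite: SilverbergZarhin1996, Thm. 6.2 and Cor. 3.3] -/
theorem matrix_eq_one_of_not_mem_exceptionalSet {A : Matrix ι ι ℤ} (hA : IsOfFinOrder A)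
    {n k : ℕ} (hnN : n ∉ exceptionalSet k) {B : Matrix ι ι ℤ}
    (hcong : (A - 1) ^ k = (n : ℤ) • B) : A = 1 := by
  have h := matrix_pow_orderBound_eq_one hA hcong
  rwa [orderBound_of_not_mem hnN, pow_one] at h

/-- **The case `k = 2`, `n = 4`** (`R(2, 4) = 2`): a periodic integral matrix with
`(A - 1)² ∈ 4 M_g(ℤ)` satisfies `A² = 1`. [cite: SilverbergZarhin1996, Thm. 6.2 (k = 2, n = 4)] -/
theorem matrix_sq_eq_one_of_sq_sub_one {A : Matrix ι ι ℤ} (hA : IsOfFinOrder A)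
    {B : Matrix ι ι ℤ} (hcong : (A - 1) ^ 2 = (4 : ℤ) • B) : A ^ 2 = 1 := by
  have h := matrix_pow_orderBound_eq_one (n := 4) (k := 2) hA (by exact_mod_cast hcong)
  rwa [orderBound_two_four] at h

/-- **The case `k = 2`, `n = 3`** (`R(2, 3) = 3`): a periodic integral matrix with
`(A - 1)² ∈ 3 M_g(ℤ)` satisfies `A³ = 1`. [cite: SilverbergZarhin1996, Thm. 6.2 (k = 2, n = 3)] -/
theorem matrix_pow_three_eq_one_of_sq_sub_one {A : Matrix ι ι ℤ} (hA : IsOfFinOrder A)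
    {B : Matrix ι ι ℤ} (hcong : (A - 1) ^ 2 = (3 : ℤ) • B) : A ^ 3 = 1 := by
  have h := matrix_pow_orderBound_eq_one (n := 3) (k := 2) hA (by exact_mod_cast hcong)
  rwa [orderBound_two_three] at h

/-- **The case `k = 2`, `n ≥ 5`**: a periodic integral matrix with `(A - 1)² ∈ n M_g(ℤ)`, `n ≥ 5`,
is the identity. [cite: SilverbergZarhin1996, Thm. 6.2 (k = 2, n ≥ 5)] -/
theorem matrix_eq_one_of_sq_sub_one {A : Matrix ι ι ℤ} (hA : IsOfFinOrder A) {n : ℕ}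
    (hn : 5 ≤ n) {B : Matrix ι ι ℤ} (hcong : (A - 1) ^ 2 = (n : ℤ) • B) : A = 1 := by
  have h := matrix_pow_orderBound_eq_one hA hcong
  rwa [orderBound_two_of_five_le hn, pow_one] at h

end Matrix


/-! ### §7 Remark 3.2: the bound `R(2, n)` is sharp (`n = 2, 3, 4`) -/

section Sharp

/-- The rotation `J = (0 -1; 1 0)` of order `4`: `(J - 1)² = -2J ∈ 2 M₂(ℤ)` and `J² = -1 ≠ 1`, so
the exponent `R(2, 2) = 4` of Theorem 6.2 cannot be lowered ("the upper bound of `R(k, n)` on the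
order of `α` in Theorem 3.1 is sharp"). [cite: SilverbergZarhin1996, Rem. 3.2] -/
theorem sharp_two_two :
    ((!![0, -1; 1, 0] : Matrix (Fin 2) (Fin 2) ℤ) - 1) ^ 2 = (2 : ℤ) • (-!![0, -1; 1, 0]) ∧
      (!![0, -1; 1, 0] : Matrix (Fin 2) (Fin 2) ℤ) ^ 4 = 1 ∧
      (!![0, -1; 1, 0] : Matrix (Fin 2) (Fin 2) ℤ) ^ 2 ≠ 1 := by
  refine ⟨by decide, by decide, by decide⟩

/-- The matrix `(0 -1; 1 -1)` of order `3` (companion matrix of `Φ₃`): `(W - 1)² = -3W ∈ 3 M₂(ℤ)`,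
`W³ = 1`, `W ≠ 1` — the exponent `R(2, 3) = 3` is attained. [cite: SilverbergZarhin1996, Rem. 3.2] -/
theorem sharp_two_three :
    ((!![0, -1; 1, -1] : Matrix (Fin 2) (Fin 2) ℤ) - 1) ^ 2 = (3 : ℤ) • (-!![0, -1; 1, -1]) ∧
      (!![0, -1; 1, -1] : Matrix (Fin 2) (Fin 2) ℤ) ^ 3 = 1 ∧
      (!![0, -1; 1, -1] : Matrix (Fin 2) (Fin 2) ℤ) ≠ 1 := by
  refine ⟨by decide, by decide, by decide⟩

/-- `-1 ∈ M₁(ℤ)`: `(-1 - 1)² = 4`, `(-1)² = 1`, `-1 ≠ 1` — the exponent `R(2, 4) = 2` is attained.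
[cite: SilverbergZarhin1996, Rem. 3.2] -/
theorem sharp_two_four :
    ((-1 : Matrix (Fin 1) (Fin 1) ℤ) - 1) ^ 2 = (4 : ℤ) • (1 : Matrix (Fin 1) (Fin 1) ℤ) ∧
      (-1 : Matrix (Fin 1) (Fin 1) ℤ) ^ 2 = 1 ∧ (-1 : Matrix (Fin 1) (Fin 1) ℤ) ≠ 1 := by
  refine ⟨by decide, by decide, by decide⟩

end Sharp

end SilverbergZarhin

end Literature.GroupTheory.ArithmeticGroups
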